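import Literature.MathematicalPhysics.QuantumLattice.IsotropicMasterSmooth
import Literature.MathematicalPhysics.QuantumLattice.SectorPropagatorL1
import HarnessLib

/-!
# Decay and `L¹` bound of the isotropic single-scale propagators (BGM 2006, Lemma 2.3 (2.60), (2.52b))

Topic `Literature/MathematicalPhysics/QuantumLattice`; the isotropic companion of
`SectorPropagatorDecay.lean` / `SectorPropagatorL1.lean`, endpoint of the chain `IsotropicSectors` →
`IsotropicPropagatorSupBound` → `IsotropicPropagatorFourier` → `IsotropicMaster` →
`IsotropicMasterSmooth`. PROVED:

* **`isoPropagator_decay`** — Lemma 2.3 (2.60) with `E_h ≡ ε`: for every `N` there is `C_N` with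
  `|ḡ^{(h)}_ω̄(x)| ≤ C_N γ^{2h} / (1 + γ^h|(x₀, x'₁, x'₂)|/(2π))^N` for all scales and isotropic sectors;
* `continuous_isoPropagator`, and **`isoPropagator_l1`** — (2.52b) at `j = 0`:
  `∫ |ḡ^{(h)}_ω̄| ≤ C γ^{-h}` (same as for the anisotropic propagators).

Everything is PROVED; the definitions are the dual rescaling data `isoDualMatrix/Lin/Equiv`.

## Sources

* G. Benfatto, A. Giuliani, V. Mastropietro, Ann. Henri Poincaré 7 (2006) 809–898, §2.5
  Lemma 2.3 (2.60) and Remark (2.52b) (arXiv:cond-mat/0507686 p. 12). [BenfattoGiulianiMastropietro2006]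
-/

noncomputable section

open Real Set Complex Function Metric MeasureTheory MeasureTheory.Measure Module
open scoped Topology FourierTransform
open Literature.Analysis.Fourier

namespace Literature.MathematicalPhysics.QuantumLattice

section Decay

variable {μ : ℝ} (hμ₁ : -4 < μ) (hμ₂ : μ < -2 - Real.sqrt 2)
include hμ₁ hμ₂

/-- The rescaled isotropic symbol is smooth. [folklore] -/
theorem contDiff_rescaledIsoSymbol {e₀ : ℝ} (he : 0 < e₀) (he' : e₀ ≤ (4 + μ) / 2) (n : ℕ) (ω : ℤ) :
    ContDiff ℝ ((⊤ : ℕ∞) : WithTop ℕ∞) (rescaledIsoSymbol hμ₁ hμ₂ e₀ n ω) := by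
  rw [rescaledIsoSymbol_eq_smul_isoMasterLift hμ₁ hμ₂ he he' n ω]
  exact (((contDiff_isoMasterLift hμ₁ hμ₂ he).comp (contDiff_const.prodMk contDiff_id))).const_smul (((4 : ℝ) ^ n : ℝ) : ℂ)

/-- The rescaled isotropic symbol is supported in the (compact) box. [folklore] -/
theorem tsupport_rescaledIsoSymbol_subset {e₀ : ℝ} (he : 0 < e₀) (he' : e₀ ≤ (4 + μ) / 2) (n : ℕ) (ω : ℤ) :
    tsupport (rescaledIsoSymbol hμ₁ hμ₂ e₀ n ω) ⊆
      {t : MomSpace | |t 0| ≤ e₀ ∧ |t 1| ≤ isoNormalConst μ e₀ ∧ |t 2| ≤ isoTangentConst μ e₀} :=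
  closure_minimal (fun _ hu => abs_le_of_rescaledIsoSymbol_ne_zero hμ₁ hμ₂ he he' hu) (isCompact_momBox _ _ _).isClosed

/-- **Lemma 2.3 of Benfatto–Giuliani–Mastropietro (2006), bound (2.60)** (`γ = 4`, `h = -n`, `E_h ≡ ε`):
for `0 < e₀ ≤ (4+μ)/2` and every `N` there is `C` with

`‖ḡ^{(h)}_ω̄(x₀, x⃗)‖ ≤ C · 4^{-n} 4^{-n} · (1 + ‖4^{-n}(x₀, x'₁, x'₂)‖/(2π))^{-N}`

for all `n`, all isotropic sectors `0 ≤ ω̄ < 2·4ⁿ` and all `(x₀, x⃗)`. [cite: BenfattoGiulianiMastropietro2006, §2.5 Lemma 2.3 (2.60)] -/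
theorem isoPropagator_decay {e₀ : ℝ} (he : 0 < e₀) (he' : e₀ ≤ (4 + μ) / 2) (N : ℕ) :
    ∃ C : ℝ, 0 ≤ C ∧ ∀ (n : ℕ) (ω : ℕ), ω < sectorCount (2 * n) → ∀ (x₀ : ℝ) (x : Fin 2 → ℝ),
      ‖isoPropagator e₀ μ n ω x₀ x‖ ≤
        C * ((4 : ℝ) ^ (-(n : ℤ)) * (4 : ℝ) ^ (-(n : ℤ))) *
          ((1 + ‖isoChartAdj μ (((ω : ℝ) + 1 / 2) * sectorWidth (2 * n)) n (dualPoint x₀ x)‖) ^ N)⁻¹ := by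
  -- `h`-uniform derivative bounds up to order `N`
  choose B hB0 hB using fun m => exists_norm_iteratedFDeriv_rescaledIsoSymbol_le hμ₁ hμ₂ he he' m
  set Bs : ℝ := ∑ m ∈ Finset.range (N + 1), B m with hBs
  have hBs0 : 0 ≤ Bs := Finset.sum_nonneg fun m _ => hB0 m
  have hBle : ∀ m ≤ N, B m ≤ Bs := fun m hm =>
    Finset.single_le_sum (fun k _ => hB0 k) (Finset.mem_range.2 (Nat.lt_succ_of_le hm))
  -- the box and its volume
  set T : Set MomSpace := {t | |t 0| ≤ e₀ ∧ |t 1| ≤ isoNormalConst μ e₀ ∧ |t 2| ≤ isoTangentConst μ e₀} with hT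
  have hTc : IsCompact T := isCompact_momBox _ _ _
  have hTfin : volume T < ⊤ := hTc.measure_lt_top
  set vol : ℝ := (volume T).toReal with hvol
  refine ⟨2 ^ N * (Bs * vol), by positivity, fun n ω hω x₀ x => ?_⟩
  -- the rescaled symbol of this sector
  set f := rescaledIsoSymbol hμ₁ hμ₂ e₀ n (ω : ℤ) with hf
  have hfc : ContDiff ℝ ((⊤ : ℕ∞) : WithTop ℕ∞) f := contDiff_rescaledIsoSymbol hμ₁ hμ₂ he he' n ω
  have hsub : tsupport f ⊆ T := tsupport_rescaledIsoSymbol_subset hμ₁ hμ₂ he he' n ω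
  have hsupp : HasCompactSupport f := hTc.of_isClosed_subset (isClosed_tsupport _) hsub
  have hM : ∀ m ≤ N, ∀ t, ‖iteratedFDeriv ℝ m f t‖ ≤ (4 : ℝ) ^ n * Bs := fun m hm t =>
    (hB m n ω hω t).trans (mul_le_mul_of_nonneg_left (hBle m hm) (by positivity))
  have hvolle : (volume (tsupport f)).toReal ≤ vol :=
    ENNReal.toReal_mono hTfin.ne (measure_mono hsub)
  -- Fourier decay of the rescaled symbol, then the decay transfer through the chart
  have hK : ∀ y, ‖𝓕 f y‖ ≤ 2 ^ N * ((4 : ℝ) ^ n * Bs * vol) * ((1 + ‖y‖) ^ N)⁻¹ := fun y =>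
    norm_fourier_le_of_iteratedFDeriv_le hfc hsupp hM hvolle y
  have h := norm_isoPropagator_le_of_fourier_decay hμ₁ hμ₂ hK x₀ x
  push_cast at h ⊢
  refine h.trans (le_of_eq ?_)
  have h44 : (4 : ℝ) ^ (-(n : ℤ)) * (4 : ℝ) ^ n = 1 := by
    rw [zpow_neg, zpow_natCast, inv_mul_cancel₀ (by positivity)]
  linear_combination (2 ^ N * Bs * vol * (4 : ℝ) ^ (-(n : ℤ)) * (4 : ℝ) ^ (-(n : ℤ)) *
    ((1 + ‖isoChartAdj μ (((ω : ℝ) + 1 / 2) * sectorWidth (2 * n)) n (dualPoint x₀ x)‖) ^ N)⁻¹) * h44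


end Decay

/-! ### The `L¹` bound -/

/-- The matrix of `q ↦ isoChartAdj μ θ₀ n (dualPoint q₀ (q₁, q₂))`. [folklore] -/
def isoDualMatrix (μ θ₀ : ℝ) (n : ℕ) : Matrix (Fin 3) (Fin 3) ℝ :=
  !![(4 : ℝ) ^ (-(n : ℤ)) / (2 * π), 0, 0;
     0, -((4 : ℝ) ^ (-(n : ℤ)) * fermiNormal μ θ₀ 0) / (2 * π), -((4 : ℝ) ^ (-(n : ℤ)) * fermiNormal μ θ₀ 1) / (2 * π);
     0, -((4 : ℝ) ^ (-(n : ℤ)) * fermiTangent μ θ₀ 0) / (2 * π), -((4 : ℝ) ^ (-(n : ℤ)) * fermiTangent μ θ₀ 1) / (2 * π)]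

/-- The rescaling map as a linear endomorphism of `ℝ³`. [folklore] -/
def isoDualLin (μ θ₀ : ℝ) (n : ℕ) : MomSpace →ₗ[ℝ] MomSpace := Matrix.toEuclideanLin (isoDualMatrix μ θ₀ n)

/-- `isoDualLin q = isoChartAdj (dualPoint q₀ (q₁, q₂))`. [folklore] -/
theorem isoDualLin_apply (μ θ₀ : ℝ) (n : ℕ) (q : MomSpace) :
    isoDualLin μ θ₀ n q = isoChartAdj μ θ₀ n (dualPoint (q 0) ![q 1, q 2]) := by
  rw [isoDualLin, Matrix.toEuclideanLin, Matrix.toLpLin_apply, isoChartAdj]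
  congr 1
  funext i
  fin_cases i <;>
    simp [isoDualMatrix, Matrix.mulVec, dotProduct, Fin.sum_univ_three, dualPoint] <;> ring

section Det

variable {μ : ℝ} (hμ₁ : -4 < μ) (hμ₂ : μ < -2 - Real.sqrt 2)
include hμ₁ hμ₂

/-- Its determinant `(2π)^{-3} (4^{-n})³`. [folklore] -/
theorem det_isoDualLin (θ₀ : ℝ) (n : ℕ) :
    LinearMap.det (isoDualLin μ θ₀ n) =
      ((4 : ℝ) ^ (-(n : ℤ)) * (4 : ℝ) ^ (-(n : ℤ)) * (4 : ℝ) ^ (-(n : ℤ))) / (2 * π) ^ 3 := by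
  have hframe := det_fermiFrameMatrix hμ₁ hμ₂ θ₀
  rw [fermiFrameMatrix, Matrix.det_fin_two_of] at hframe
  rw [isoDualLin, Matrix.toEuclideanLin, LinearMap.det_toLpLin, isoDualMatrix, Matrix.det_fin_three]
  simp only [Matrix.of_apply, Matrix.cons_val', Matrix.cons_val_zero, Matrix.cons_val_one, Matrix.cons_val_two,
    Matrix.empty_val', Matrix.cons_val_fin_one, Matrix.head_cons, Matrix.tail_cons, Matrix.head_fin_const]
  have hπ : (2 * π) ≠ 0 := by positivity
  field_simp
  linear_combination ((4 : ℝ) ^ (-(n : ℤ))) ^ 2 * hframe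

/-- The determinant is positive. [folklore] -/
theorem det_isoDualLin_pos (θ₀ : ℝ) (n : ℕ) : 0 < LinearMap.det (isoDualLin μ θ₀ n) := by
  rw [det_isoDualLin hμ₁ hμ₂]; positivity

/-- The rescaling map as a continuous linear automorphism. [folklore] -/
def isoDualEquiv (θ₀ : ℝ) (n : ℕ) : MomSpace ≃L[ℝ] MomSpace :=
  (LinearMap.equivOfDetNeZero (isoDualLin μ θ₀ n) (det_isoDualLin_pos hμ₁ hμ₂ θ₀ n).ne').toContinuousLinearEquiv

/-- The automorphism acts as the rescaling map. [folklore] -/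
theorem isoDualEquiv_apply (θ₀ : ℝ) (n : ℕ) (q : MomSpace) :
    isoDualEquiv hμ₁ hμ₂ θ₀ n q = isoChartAdj μ θ₀ n (dualPoint (q 0) ![q 1, q 2]) := by
  rw [← isoDualLin_apply]; rfl

/-- Its determinant. [folklore] -/
theorem det_isoDualEquiv (θ₀ : ℝ) (n : ℕ) :
    LinearMap.det ((isoDualEquiv hμ₁ hμ₂ θ₀ n : MomSpace ≃ₗ[ℝ] MomSpace) : MomSpace →ₗ[ℝ] MomSpace) =
      ((4 : ℝ) ^ (-(n : ℤ)) * (4 : ℝ) ^ (-(n : ℤ)) * (4 : ℝ) ^ (-(n : ℤ))) / (2 * π) ^ 3 := by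
  rw [← det_isoDualLin hμ₁ hμ₂ θ₀ n]; rfl

end Det

/-! ### Continuity -/

section L1

variable {μ : ℝ} (hμ₁ : -4 < μ) (hμ₂ : μ < -2 - Real.sqrt 2)
include hμ₁ hμ₂

/-- The symbol on `ℝ³` is continuous with compact support, hence integrable. [folklore] -/
theorem integrable_isoSymbolE {e₀ : ℝ} (he : 0 < e₀) (he' : e₀ ≤ (4 + μ) / 2) (n : ℕ) (ω : ℤ) :
    Continuous (isoSymbolE e₀ μ n ω) ∧ Integrable (isoSymbolE e₀ μ n ω) := by
  set θ₀ : ℝ := ((ω : ℝ) + 1 / 2) * sectorWidth (2 * n) with hθ₀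
  set A := isoChart hμ₁ hμ₂ θ₀ n with hA
  set φ : MomSpace ≃ₜ MomSpace := (Homeomorph.addRight (-fermiBasePoint μ θ₀)).trans A.symm.toHomeomorph with hφ
  have heq : isoSymbolE e₀ μ n ω = rescaledIsoSymbol hμ₁ hμ₂ e₀ n ω ∘ φ := by
    rw [isoSymbolE_eq_comp hμ₁ hμ₂]; rfl
  have hR : Continuous (rescaledIsoSymbol hμ₁ hμ₂ e₀ n ω) := (contDiff_rescaledIsoSymbol hμ₁ hμ₂ he he' n ω).continuous
  have hRs : HasCompactSupport (rescaledIsoSymbol hμ₁ hμ₂ e₀ n ω) :=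
    (isCompact_momBox _ _ _).of_isClosed_subset (isClosed_tsupport _) (tsupport_rescaledIsoSymbol_subset hμ₁ hμ₂ he he' n ω)
  have hc : Continuous (isoSymbolE e₀ μ n ω) := by rw [heq]; exact hR.comp φ.continuous
  exact ⟨hc, by rw [heq]; exact (hR.comp φ.continuous).integrable_of_hasCompactSupport (hRs.comp_homeomorph φ)⟩

/-- **The isotropic propagator is continuous in `(x₀, x⃗)`.** [folklore] -/
theorem continuous_isoPropagator {e₀ : ℝ} (he : 0 < e₀) (he' : e₀ ≤ (4 + μ) / 2) (n : ℕ) (ω : ℤ) :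
    Continuous fun p : ℝ × (Fin 2 → ℝ) => isoPropagator e₀ μ n ω p.1 p.2 := by
  have hF : Continuous (𝓕 (isoSymbolE e₀ μ n ω)) :=
    VectorFourier.fourierIntegral_continuous Real.continuous_fourierChar (by exact continuous_inner)
      (integrable_isoSymbolE hμ₁ hμ₂ he he' n ω).2
  have heq : (fun p : ℝ × (Fin 2 → ℝ) => isoPropagator e₀ μ n ω p.1 p.2) =
      𝓕 (isoSymbolE e₀ μ n ω) ∘ fun p : ℝ × (Fin 2 → ℝ) => dualPoint p.1 p.2 := by
    funext p; exact isoPropagator_eq_fourier e₀ μ n ω p.1 p.2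
  rw [heq]
  exact hF.comp continuous_dualPoint

/-! ### The `L¹` bound -/

/-- **The `L¹` bound (2.52b) (`j = 0`) of Benfatto–Giuliani–Mastropietro (2006) for the isotropic
propagators**: there is `C` with `ḡ^{(h)}_ω̄ ∈ L¹(ℝ × ℝ²)` and `∫ |ḡ^{(h)}_ω̄| ≤ C 4ⁿ = C γ^{-h}` for all `n`
and all isotropic sectors `0 ≤ ω̄ < 2·4ⁿ` ("the dimensional bound on the integral of an isotropic
propagator is the same as the bound on the integral of an anisotropic one"). [cite: BenfattoGiulianiMastropietro2006, §2.5 (2.52b)] -/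
theorem isoPropagator_l1 {e₀ : ℝ} (he : 0 < e₀) (he' : e₀ ≤ (4 + μ) / 2) :
    ∃ C : ℝ, 0 ≤ C ∧ ∀ (n : ℕ) (ω : ℕ), ω < sectorCount (2 * n) →
      Integrable (fun p : ℝ × (Fin 2 → ℝ) => isoPropagator e₀ μ n ω p.1 p.2) ∧
        ∫ p : ℝ × (Fin 2 → ℝ), ‖isoPropagator e₀ μ n ω p.1 p.2‖ ≤ C * (4 : ℝ) ^ n := by
  obtain ⟨C₀, hC₀, hdec⟩ := isoPropagator_decay hμ₁ hμ₂ he he' 4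
  set I : ℝ := ∫ u : MomSpace, ((1 + ‖u‖) ^ 4)⁻¹ with hI
  have hI0 : 0 ≤ I := integral_nonneg fun u => by positivity
  refine ⟨C₀ * (2 * π) ^ 3 * I, by positivity, fun n ω hω => ?_⟩
  set θ₀ : ℝ := ((ω : ℝ) + 1 / 2) * sectorWidth (2 * n) with hθ₀
  set W := isoDualEquiv hμ₁ hμ₂ θ₀ n with hW
  set F : MomSpace → ℝ := fun u => ((1 + ‖u‖) ^ 4)⁻¹ with hF
  set g : ℝ × (Fin 2 → ℝ) → ℂ := fun p => isoPropagator e₀ μ n ω p.1 p.2 with hg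
  set c : ℝ := C₀ * ((4 : ℝ) ^ (-(n : ℤ)) * (4 : ℝ) ^ (-(n : ℤ))) with hc
  have hc0 : 0 ≤ c := by positivity
  -- the dominating function `b(p) = c F(W(splitMomentum⁻¹ p))`
  set b : ℝ × (Fin 2 → ℝ) → ℝ := fun p => c * F (isoChartAdj μ θ₀ n (dualPoint p.1 p.2)) with hb
  have hgb : ∀ p, ‖g p‖ ≤ b p := fun p => by
    have := hdec n ω hω p.1 p.2
    simpa [hg, hb, hc, hF, hθ₀, mul_assoc, mul_comm, mul_left_comm] using this
  -- `b ∘ splitMomentum = c • (F ∘ W)`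
  have hbW : (b ∘ splitMomentum) = fun q => c * F (W q) := by
    funext q
    simp only [Function.comp_apply, hb, splitMomentum_apply, hW, isoDualEquiv_apply]
  -- integrability of `F ∘ W` and the value of its integral
  have hdetW : LinearMap.det ((W : MomSpace ≃ₗ[ℝ] MomSpace) : MomSpace →ₗ[ℝ] MomSpace) ≠ 0 := by
    rw [hW, det_isoDualEquiv hμ₁ hμ₂]; positivity
  have hFW : Integrable (fun q => F (W q)) := by
    have hmap : Measure.map (W : MomSpace → MomSpace) volume =
        ENNReal.ofReal |(LinearMap.det ((W : MomSpace ≃ₗ[ℝ] MomSpace) : MomSpace →ₗ[ℝ] MomSpace))⁻¹| • volume :=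
      map_linearMap_addHaar_eq_smul_addHaar volume hdetW
    have h1 : Integrable F (Measure.map (W : MomSpace → MomSpace) volume) := by
      rw [hmap]; exact integrable_inv_one_add_norm_pow_four.smul_measure ENNReal.ofReal_ne_top
    exact (integrable_map_equiv W.toHomeomorph.toMeasurableEquiv F).1 h1
  have hintFW : ∫ q, F (W q) = (2 * π) ^ 3 * ((4 : ℝ) ^ n * (4 : ℝ) ^ n * (4 : ℝ) ^ n) * I := by
    rw [integral_comp_continuousLinearEquiv volume W F, det_isoDualEquiv hμ₁ hμ₂, smul_eq_mul, ← hI]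
    congr 1
    rw [abs_of_pos (by positivity), inv_div, zpow_neg, zpow_natCast]
    field_simp
  -- integrability and integral of `b`
  have hbi : Integrable b := by
    rw [← measurePreserving_splitMomentum.integrable_comp_emb splitMomentum.measurableEmbedding, hbW]
    exact hFW.const_mul c
  have hbint : ∫ p, b p = C₀ * (2 * π) ^ 3 * I * (4 : ℝ) ^ n := by
    rw [← measurePreserving_splitMomentum.integral_comp splitMomentum.measurableEmbedding]
    change ∫ q, (b ∘ splitMomentum) q = _
    rw [hbW, integral_const_mul, hintFW, hc]
    have h4 : (4 : ℝ) ^ (-(n : ℤ)) * (4 : ℝ) ^ n = 1 := by rw [zpow_neg, zpow_natCast, inv_mul_cancel₀ (by positivity)]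
    linear_combination (C₀ * (2 * π) ^ 3 * I * (4 : ℝ) ^ n * ((4 : ℝ) ^ (-(n : ℤ)) * (4 : ℝ) ^ n)) * h4 +
      (C₀ * (2 * π) ^ 3 * I * (4 : ℝ) ^ n) * h4
  -- conclude
  have hgm : AEStronglyMeasurable g volume := (continuous_isoPropagator hμ₁ hμ₂ he he' n ω).aestronglyMeasurable
  have hgi : Integrable g := Integrable.mono' hbi hgm (ae_of_all _ hgb)
  refine ⟨hgi, ?_⟩
  calc ∫ p, ‖g p‖ ≤ ∫ p, b p := integral_mono hgi.norm hbi hgb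
    _ = C₀ * (2 * π) ^ 3 * I * (4 : ℝ) ^ n := hbint

end L1

end Literature.MathematicalPhysics.QuantumLattice

end
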